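import Literature.Combinatorics.Optimization.ShellLawGeneratingPolynomial
import Literature.Probability.Distributions.LevelZeroShellLawTail
import HarnessLib

/-!
# The `x`-smoothness of a shell law with the atypical hypergeometric weight priced by a Chernoff bound

Continuation of `ShellLawGeneratingPolynomial.lean` §6–§7. For a fixed-point-free involution `π` (a perfect
matching), a `π`-stable ground set `S` with `a` edges of type `HH` relative to a block `H`, a level `c`
and `s` full edges (`N′ = |S|/2 − c` edges remain after stripping any admissible half-set), §6 there
(`sum_abs_nab2_iter_shellLaw_le_threshold`) bounds the `x`-smoothness number
`Σ_{x∈win} |(∇²)^m law_S(c+2s,·)(c)(x)|` by the Gaussian-grade term `(2√192·√(4m/V₀))^{2m}` on the typical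
mixture components `(Y, α)` (at least `r₀` of the `s` full edges NOT of type `HH`, variance `≥ V₀`) plus
`4^m` times the normalised weight of the ATYPICAL components `α ≥ s + 1 − r₀`; §7 there prices that weight
by the factorial-moment bound `C(s,k)C(a,k)/C(N′,k)`, which is small only for `r₀ = O(N′/log N′)`.
Here the atypical weight is priced instead by the parametrised Chernoff bound of the tree
(`PoissonBinomial.hyperGen_upperTail_le_exp_param`: the number `α` of `HH` edges among `s` edges drawn
from `N′` is hypergeometric with mean `s·a_Y/N′ ≤ s·a/N′`), which is exponentially small in `N′` for
`r₀` a constant fraction of `N′`: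

* §1 `choose_mul_choose_atypical_le_exp` — `Σ_{α ≤ s, α ≥ s+1−r₀} C(a,α)C(M,s−α) ≤
  C(a+M,s)·exp((u+u²)·s·a/(a+M) − u·(s+1−r₀))` for every `u ∈ [0,1]` (`s ≤ a + M`).
* §2 **`sum_abs_nab2_iter_shellLaw_le_exp`** — under the typical-variance hypothesis of §7 there and
  `s ≤ N′`: `Σ_{x∈win} |(∇²)^m law_S(c+2s,·)(c)(x)| ≤ (2√192·√(4m/V₀))^{2m} +
  4^m·exp((u+u²)·s·a/N′ − u·(s+1−r₀))`, every `u ∈ [0,1]`.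

All PROVED, 0 sorry, no definitions, no named facts. Cell pnp-psdrank (prover g25): the input that makes
the per-matching x-smoothness remainders of Theorems bricks 117–124 uniform in the cut size `t` at a
CONSTANT type margin `β` (brick 125 `ChebyshevTracialDesignCrossingPlaneByType`).

## References

* [RollinRoss2010] A. Röllin, N. Ross, *Local limit theorems via Landau–Kolmogorov inequalities*,
  Bernoulli 21 (2015) 851–880 = arXiv:1011.3100, §3 Lemma 3.3 (smoothness of mixtures).
* [Durrett2019] R. Durrett, *Probability: Theory and Examples*, 5th ed. (2019), §2.7 (exponential
  Markov / Chernoff bounds).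
* [VatutinMikhailov1983] V. A. Vatutin, V. G. Mikhailov, Theory Probab. Appl. 27:4 (1983) 734–743, §2
  (the hypergeometric law is a Bernoulli sum).
* [Rothvoss2017] T. Rothvoß, *The matching polytope has exponential extension complexity*, J. ACM 64
  (2017), §2 (PDF pp. 5–6): cuts, perfect matchings, the three edge types.
-/

noncomputable section

open Finset Polynomial

namespace Literature.Combinatorics.Optimization

namespace ShellStep

open Literature.Combinatorics.StablePolynomials
open Literature.Probability.Distributions.PoissonBinomial (hyperGen_upperTail_le_exp_param)

variable {n : ℕ} {π : Fin n → Fin n}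

/-! ### §1 The atypical hypergeometric weight under a Chernoff bound -/

/-- **Chernoff bound for the atypical weight of one mixture component family.** For `s ≤ a + M` draws
from `a` marked (`HH`) and `M` unmarked edges, the weight of the draws with at least `s + 1 − r₀` marked
edges is `Σ_{α ≤ s, ¬(α + r₀ ≤ s)} C(a,α)·C(M,s−α) ≤ C(a+M,s)·exp((u+u²)·(s·a/(a+M)) − u·(s+1−r₀))` for
every `u ∈ [0,1]`. [cite: Durrett2019, §2.7] [cite: VatutinMikhailov1983, §2] -/
theorem choose_mul_choose_atypical_le_exp (a M s r₀ : ℕ) (hs : s ≤ a + M) {u : ℝ} (hu0 : 0 ≤ u)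
    (hu1 : u ≤ 1) :
    (∑ α ∈ range (s + 1),
        if α + r₀ ≤ s then (0 : ℝ) else ((a.choose α : ℕ) : ℝ) * ((M.choose (s - α) : ℕ) : ℝ)) ≤
      (((a + M).choose s : ℕ) : ℝ) *
        Real.exp ((u + u ^ 2) * ((s : ℝ) * a / ((a : ℝ) + M)) - u * ((s : ℝ) + 1 - r₀)) := by
  have hsel : (∑ α ∈ range (s + 1),
      if α + r₀ ≤ s then (0 : ℝ) else ((a.choose α : ℕ) : ℝ) * ((M.choose (s - α) : ℕ) : ℝ)) =
      ∑ k ∈ (range (s + 1)).filter (fun k : ℕ => ((s : ℝ) + 1 - r₀) ≤ (k : ℝ)),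
        (hyperGen a M s).coeff k := by
    rw [sum_filter]
    refine sum_congr rfl fun α hα => ?_
    have hαs : α ≤ s := by have := mem_range.1 hα; omega
    rw [coeff_hyperGen, if_pos hαs]
    by_cases h : α + r₀ ≤ s
    · have h' : ¬ ((s : ℝ) + 1 - r₀ ≤ (α : ℝ)) := by
        intro h'
        have h2 : ((α + r₀ : ℕ) : ℝ) ≤ s := by exact_mod_cast h
        push_cast at h2
        linarith
      rw [if_pos h, if_neg h']
    · have h2 : s + 1 ≤ α + r₀ := by omega
      have h' : (s : ℝ) + 1 - r₀ ≤ (α : ℝ) := by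
        have h3 : ((s + 1 : ℕ) : ℝ) ≤ ((α + r₀ : ℕ) : ℝ) := by exact_mod_cast h2
        push_cast at h3
        linarith
      rw [if_neg h, if_pos h', Nat.cast_mul]
  rw [hsel]
  exact hyperGen_upperTail_le_exp_param hs hu0 hu1 _

/-! ### §2 The `x`-smoothness of a shell law with the Chernoff-priced atypical weight -/

variable (hπ : ∀ v, π (π v) = v) (hπ' : ∀ v, π v ≠ v)
include hπ hπ'

/-- **The `x`-smoothness of a shell law, atypical weight by Chernoff.** For a `π`-stable ground set `S`
(with `a` edges of type `HH`, `N′ = |S|/2 − c`), block `H`, level `c`, `s ≤ N′` full edges, every `m`,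
every finite window, every `V₀ > 0` with `2m − 1 ≤ 2V₀`, every `r₀` such that the hypergeometric
components with at least `r₀` non-`HH` draws have variance `≥ V₀`, and every `u ∈ [0,1]`:
`Σ_{x ∈ win} |(∇²)^m law_S(c+2s,·)(c)(x)| ≤ (2√192·√(4m/V₀))^{2m} + 4^m·exp((u+u²)·s·a/N′ − u·(s+1−r₀))`.
[cite: RollinRoss2010, Lemma 3.3] [cite: Durrett2019, §2.7] [cite: Rothvoss2017, §2 (PDF p. 6)] -/
theorem sum_abs_nab2_iter_shellLaw_le_exp {S : Finset (Fin n)} (hS : ∀ v ∈ S, π v ∈ S)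
    (H : Finset (Fin n)) (c s m r₀ : ℕ) (win : Finset ℤ) {V₀ : ℝ} (hV₀ : 0 < V₀)
    (hm : (2 * m : ℝ) - 1 ≤ 2 * V₀)
    (hV : ∀ Y ∈ halfSets π S c, ∀ α ∈ range (s + 1), α + r₀ ≤ s →
      V₀ ≤ ((s - α : ℕ) : ℝ) * (reps π (vBH π (strip π S Y) H ∪ vBN π (strip π S Y) H)).card *
          (reps π (vDD π (strip π S Y) H)).card *
          (((reps π (vBH π (strip π S Y) H ∪ vBN π (strip π S Y) H)).card : ℝ) +
            (reps π (vDD π (strip π S Y) H)).card - ((s - α : ℕ) : ℝ)) /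
        ((((reps π (vBH π (strip π S Y) H ∪ vBN π (strip π S Y) H)).card : ℝ) +
            (reps π (vDD π (strip π S Y) H)).card) ^ 2 *
          (((reps π (vBH π (strip π S Y) H ∪ vBN π (strip π S Y) H)).card : ℝ) +
            (reps π (vDD π (strip π S Y) H)).card - 1)))
    (hsN : s ≤ S.card / 2 - c) {u : ℝ} (hu0 : 0 ≤ u) (hu1 : u ≤ 1) :
    ∑ x ∈ win, |nab2^[m] (fun c' x => shellLaw π S H (c + 2 * s) c' x : Profile) c x| ≤
      (2 * Real.sqrt 192 * Real.sqrt (4 * m / V₀)) ^ (2 * m) +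
        (4 : ℝ) ^ m * Real.exp ((u + u ^ 2) * ((s : ℝ) * (reps π (vAA π S H)).card / ((S.card / 2 - c : ℕ) : ℝ)) -
          u * ((s : ℝ) + 1 - r₀)) := by
  classical
  refine (sum_abs_nab2_iter_shellLaw_le_threshold hπ hπ' hS H c s m win hV₀ hm (fun Y α => α + r₀ ≤ s)
    (fun Y hY α hα hT => hV Y hY α hα hT)).trans ?_
  have h4 : (0 : ℝ) ≤ (4 : ℝ) ^ m := by positivity
  refine add_le_add le_rfl (mul_le_mul_of_nonneg_left ?_ h4)
  have hκ : 0 ≤ 1 / ((shellIn π S (c + 2 * s) c).card : ℝ) := by positivity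
  set B : ℝ := Real.exp ((u + u ^ 2) * ((s : ℝ) * (reps π (vAA π S H)).card / ((S.card / 2 - c : ℕ) : ℝ)) -
    u * ((s : ℝ) + 1 - r₀)) with hB
  have hB0 : 0 ≤ B := (Real.exp_pos _).le
  -- per half-set: Chernoff, then `a_Y ≤ a`
  have hper : ∀ Y ∈ halfSets π S c,
      (∑ α ∈ range (s + 1),
        if α + r₀ ≤ s then (0 : ℝ) else
          (((reps π (vAA π (strip π S Y) H)).card.choose α : ℕ) : ℝ) *
            ((((reps π (vBH π (strip π S Y) H ∪ vBN π (strip π S Y) H)).card +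
              (reps π (vDD π (strip π S Y) H)).card).choose (s - α) : ℕ) : ℝ)) ≤
        (((S.card / 2 - c).choose s : ℕ) : ℝ) * B := by
    intro Y hY
    have hN := typeReps_strip_eq hπ hπ' hS H hY
    have haY := reps_vAA_strip_le (π := π) S H Y
    set aY := (reps π (vAA π (strip π S Y) H)).card with haYdef
    set MY := (reps π (vBH π (strip π S Y) H ∪ vBN π (strip π S Y) H)).card +
      (reps π (vDD π (strip π S Y) H)).card with hMYdef
    have hsY : s ≤ aY + MY := by rw [hN]; exact hsN
    refine (choose_mul_choose_atypical_le_exp aY MY s r₀ hsY hu0 hu1).trans ?_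
    rw [hN]
    refine mul_le_mul_of_nonneg_left (Real.exp_le_exp.2 ?_) (by positivity)
    have hcast : ((aY : ℝ) + MY) = ((S.card / 2 - c : ℕ) : ℝ) := by rw [← hN]; push_cast; ring
    rw [hcast]
    have huu : 0 ≤ u + u ^ 2 := by positivity
    have hfrac : (s : ℝ) * aY / ((S.card / 2 - c : ℕ) : ℝ) ≤
        (s : ℝ) * (reps π (vAA π S H)).card / ((S.card / 2 - c : ℕ) : ℝ) := by
      refine div_le_div_of_nonneg_right (mul_le_mul_of_nonneg_left ?_ (Nat.cast_nonneg _)) (Nat.cast_nonneg _)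
      exact_mod_cast haY
    nlinarith [mul_le_mul_of_nonneg_left hfrac huu]
  -- the shell size: `|Shell| = Σ_Y C(N′, s)`
  have hcard : ((shellIn π S (c + 2 * s) c).card : ℝ) =
      ∑ Y ∈ halfSets π S c, (((S.card / 2 - c).choose s : ℕ) : ℝ) := by
    rw [card_shellIn_eq_sum_halfSets_types hπ hπ' hS H c s]
    refine sum_congr rfl fun Y hY => ?_
    rw [← typeReps_strip_eq hπ hπ' hS H hY, Nat.add_choose_eq,
      Finset.Nat.sum_antidiagonal_eq_sum_range_succ
        (fun i j => (reps π (vAA π (strip π S Y) H)).card.choose i *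
          ((reps π (vBH π (strip π S Y) H ∪ vBN π (strip π S Y) H)).card +
            (reps π (vDD π (strip π S Y) H)).card).choose j) s]
    push_cast
    rfl
  calc 1 / ((shellIn π S (c + 2 * s) c).card : ℝ) *
        ∑ Y ∈ halfSets π S c, ∑ α ∈ range (s + 1),
          (if α + r₀ ≤ s then (0 : ℝ) else
            (((reps π (vAA π (strip π S Y) H)).card.choose α : ℕ) : ℝ) *
              ((((reps π (vBH π (strip π S Y) H ∪ vBN π (strip π S Y) H)).card +
                (reps π (vDD π (strip π S Y) H)).card).choose (s - α) : ℕ) : ℝ))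
      ≤ 1 / ((shellIn π S (c + 2 * s) c).card : ℝ) *
          ∑ Y ∈ halfSets π S c, (((S.card / 2 - c).choose s : ℕ) : ℝ) * B :=
        mul_le_mul_of_nonneg_left (sum_le_sum hper) hκ
    _ = 1 / ((shellIn π S (c + 2 * s) c).card : ℝ) * ((shellIn π S (c + 2 * s) c).card : ℝ) * B := by
        rw [← sum_mul, ← hcard, mul_assoc]
    _ ≤ B := by
        by_cases h0 : ((shellIn π S (c + 2 * s) c).card : ℝ) = 0
        · rw [h0, mul_zero, zero_mul]; exact hB0
        · rw [one_div_mul_cancel h0, one_mul]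

end ShellStep

end Literature.Combinatorics.Optimization

end
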